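import Literature.MathematicalPhysics.QuantumFieldTheory.Balaban1983to89.B8Eq191FlatDirichletCoercive

/-!
# `Balaban1983to89.B8Eq191FlatDirichletDistance` — [Balaban1984PropagatorsII] (2.46) p. 231 READ AT SITES: the SCALED SITE DISTANCE `d_σ` on a finite region `S ⊂ ℤᵈ`
# (nearest-neighbour walks in `S`, a fine bond costing `min(σ(x), σ(z))`, `σ = L⁻ʲ` on the level-`j` tower blocks — «A part of Γ contained in Bʲ(Λ_j) consists of bonds of
# the lattice Λ_j»), its BOND-LIPSCHITZ property, and the admissible exponents `ρ = c·d_σ(x₀, ·)` of the flat Dirichlet exponential conjugation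
# (`B8Eq191FlatDirichletLipschitzExponent`) — definitions for the (R1′) programme of DAG node N05

statement-level skeleton of published theorems with citation tags; proofs where landed; nothing here is a claim about the
Yang–Mills mass gap

T. Bałaban, *Propagators and renormalization transformations for lattice gauge theories. II*, Commun. Math. Phys. **96** (1984) 223–250 `[Balaban1984PropagatorsII]`
("B6"), p. 231 (2.45)–(2.46), verbatim: «let us introduce the following distance in 𝔅: for y, y′ ∈ 𝔅 d(y, y′) = inf_Γ |Γ|, where Γ is a contour joining y and y′, built
of admissible bonds, and |Γ| is the number of these bonds. A part of Γ contained in Bʲ(Λ_j) consists of bonds of the lattice Λ_j. (2.46) … d(x, x′) = d(y, y′) if x ∈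
Bʲ(y), x′ ∈ Bʲ′(y′)», Lemma 2.1 (2.61) p. 234, p. 228 («G(Ω) = (ΩΔ_aΩ)⁻¹»); [B5] = `[Balaban1984PropagatorsI]` p. 36 (exponential conjugation); [B8] =
`[Balaban1985RegularSpaces]` (1.101) p. 93, (1.5)–(1.6) p. 77, p. 79.

CITATION HEADER (lean-in-tree rule).  Cell `pub-ymgap` (YM Track A, HUMAN RULING D-0062), DAG node N05 = [B8], seat `pub-ymgap-dag-n05-c` (g8), programme (R1′) = [4] Thms
3.1∕3.2 at `U₀ = 1` with Dirichlet conditions for `B8Prop6CubeMemberFlatScalar.prop6_cubeMember_flat_of_real` (memo `R1PRIME-PROGRAMME.md`, seat HOME).  Bricks 1–3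
(`B8Eq191FlatDirichletCoercive`, `…Conjugation`, `…LipschitzExponent`) reduce the weighted-`ℓ²` decay of the flat Dirichlet multi-level Green's function to ONE hypothesis on
the exponent: bond-Lipschitz at the tower scale, `|ρ(x) − ρ(x ± e_μ)| ≤ δ′L⁻ʲ` at level-`j` tower sites.  THIS FILE supplies the OBJECT that realises it — the site version
of print's block distance (2.46), a coarse bond of `Λ_j` read as `Lʲ` fine bonds of cost `L⁻ʲ` each — so that `ρ = c·d_σ(x₀, ·)` is admissible for every base point.

WHAT IS DECLARED ∕ PROVED.
* §1 `nnGraph S` (the nearest-neighbour `SimpleGraph` of the region: `x ~ z` iff `x, z ∈ S`, `z = x ± e_μ`), `walkCost S σ` (a fine bond `⟨x,z⟩` costs `min(σ x, σ z)`;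
  structural recursion on `SimpleGraph.Walk`), `lsDist S σ x z = ⨅_{walks} cost` (junk `0` when unreachable — Mathlib's `Real.iInf_of_isEmpty`).
* §2 `walkCost_nil ∕ _cons ∕ _append`, `walkCost_nonneg`, `lsDist_nonneg`, `lsDist_self`.
* §3 ★ `lsDist_le_lsDist_add` (bond step: `d(w,z) ≤ d(w,x) + min(σ x, σ z)` for a bond `⟨x,z⟩`; extend every walk by the bond; the unreachable case is `0 ≤ 0 + min`),
  ★ `abs_lsDist_sub_lsDist_le` (BOND-LIPSCHITZ: `|d(w,x) − d(w,z)| ≤ min(σ x, σ z)`).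
* §4 `adj_add_e ∕ adj_sub_e`, ★★ `lipschitz_of_lsDist`: if `σ ≤ L⁻ʲ` at level-`j` tower sites then `ρ = c·d_σ(x₀,·)`, `|c| ≤ δ′`, satisfies the `hlip` hypothesis of
  `B8Eq191FlatDirichletLipschitzExponent.agmon_solve_flatDirichlet_of_lipschitz` verbatim.
* §5 `towerScale_eq ∕ _nonneg` (the tower scale `σ(x) = Σ_j[Bʲ(x)∈Λ_j]L⁻ʲ` equals `L⁻ʲ` at a level-`j` site when a site lies in at most one tower block), ★★
  `lipschitz_of_towerDist` (`hlip` for `ρ = c·d_σ(x₀,·)` with the tower scale, every `x₀`, every `|c| ≤ δ′`).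
* §6 ★ `abs_sub_le_walkCost` ∕ ★★ `abs_sub_le_lsDist` — THE TEST-FUNCTION PRINCIPLE: a bond-Lipschitz `F` (`|F u − F v| ≤ min(σ u, σ v)`) gives the LOWER bound
  `|F(x) − F(z)| ≤ d_σ(x,z)` for reachable pairs (how the collar-crossing bounds of brick 4b are to be proved: exhibit a depth potential).
* §7 `reachable_add_nsmul_e` (the endpoints of a lattice segment lying in `S` are reachable in the region graph).

HONEST SCOPE.  Definitions + order bookkeeping on `ℝ`-valued infima; NO estimate.  Not typed here (next bricks): the LOWER bounds of `d_σ` (a walk crossing a collar of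
width `ρ_c` blocks costs `≥ ρ_c`; [B6] Lemma 2.1 (2.61)'s counting `sup_y Σ_{y′} e^{−αδ₀d(y,y′)} ≤ c₁(α)` on the cube member — where the margin threshold of bus
«LOCATED-ρ» enters), symmetry∕triangle inequality (not needed by the consumer), reachability inside `□₀`.  The junk value `0` for unreachable pairs is harmless for the
Lipschitz property (both sides of a bond are reachable or neither).  Count-neutral; N05 NOT discharged; one finite `T⁴` programme at fixed `ε`, Bałaban as printed; nothing
continuum ∕ ℝ⁴ ∕ OS ∕ mass-gap ∕ Clay.  No `sorry`, no `instance`, no `notation`; three `def`s (`nnGraph`, `walkCost`, `lsDist`), 17 theorems.  Unit `pub-ymgap-dag-n05-c` (g8), 2026-08-27.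

RELATED IN THE TREE, NOT DUPLICATED (searched 2026-08-27T11:30Z: `rg -l 'Walk|SimpleGraph.dist' Balaban1983to89/B6Geom246MultiLevelBox.lean B4*.lean`; `rg -n 'def .*Dist'
QuantumLattice/`): `B6Geom246MultiLevelBox.bond ∕ csys` (p21: the (2.46) graph on the BLOCK set `bset` of the Neumann-box family `Domains`, unit cost per admissible bond,
`ContourSystem` — the block-level object of the random-walk expansion; other carrier, not a site exponent), Mathlib `SimpleGraph.dist` (unweighted).  Nothing in the tree
gives a weighted walk cost on the `ℤᵈ`∕`blockMap` carrier of `B8Eq191FlatDirichletForm`.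
-/

noncomputable section

namespace Literature.MathematicalPhysics.QuantumFieldTheory.Balaban1983to89.B8Eq191FlatDirichletDistance

open Finset
open B7Prop1Explicit (e)
open Literature.MathematicalPhysics.QuantumLattice (blockMap)

variable {d : ℕ}

/-! ## §1 The nearest-neighbour graph of a finite region `S ⊂ ℤᵈ` and the scaled cost of a walk -/

/-- **The nearest-neighbour graph of the region `S`**: `x ~ z` iff both lie in `S` and `z = x ± e_μ` for some direction `μ` (the fine bonds of [B6] (2.46) inside the
region; print: «Γ is a contour joining y and y′, built of admissible bonds»). [cite: Balaban1984PropagatorsII, (2.46) p.231; Balaban1985RegularSpaces, p.77 («Ω also the set of bonds with at least one end-point in Ω»)] -/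
def nnGraph (S : Finset (Fin d → ℤ)) : SimpleGraph (Fin d → ℤ) where
  Adj x z := x ∈ S ∧ z ∈ S ∧ x ≠ z ∧ ∃ μ : Fin d, z = x + e μ ∨ x = z + e μ
  symm := ⟨by
    rintro x z ⟨hx, hz, hne, μ, h⟩
    exact ⟨hz, hx, hne.symm, μ, h.symm⟩⟩
  loopless := ⟨by
    rintro x ⟨-, -, hne, -⟩
    exact hne rfl⟩

/-- **The scaled cost of a walk**: a bond `⟨x, z⟩` costs `min(σ(x), σ(z))` — with `σ = L⁻ʲ` on `Bʲ(Λ_j)` this is [B6] (2.46) read at sites («A part of Γ contained in Bʲ(Λ_j)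
consists of bonds of the lattice Λ_j»: `Lʲ` fine bonds per coarse bond). [cite: Balaban1984PropagatorsII, (2.46) p.231] -/
def walkCost (S : Finset (Fin d → ℤ)) (σ : (Fin d → ℤ) → ℝ) : {x z : Fin d → ℤ} → (nnGraph S).Walk x z → ℝ
  | _, _, SimpleGraph.Walk.nil => 0
  | x, _, SimpleGraph.Walk.cons (v := y) _ p => min (σ x) (σ y) + walkCost S σ p

/-- **The scaled site distance** `d_σ(x, z) = inf_Γ cost(Γ)` over nearest-neighbour walks in `S` (junk value `0` if `z` is not reachable from `x`).
[cite: Balaban1984PropagatorsII, (2.46) p.231 («d(y, y′) = inf_Γ |Γ|»)] -/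
def lsDist (S : Finset (Fin d → ℤ)) (σ : (Fin d → ℤ) → ℝ) (x z : Fin d → ℤ) : ℝ :=
  ⨅ p : (nnGraph S).Walk x z, walkCost S σ p

/-! ## §2 Elementary facts: cost of `nil`, `cons`, `append`; non-negativity; the distance of a site to itself -/

variable (S : Finset (Fin d → ℤ)) (σ : (Fin d → ℤ) → ℝ)

/-- The empty walk costs nothing. [cite: Balaban1984PropagatorsII, (2.46) p.231] -/
@[simp] theorem walkCost_nil (x : Fin d → ℤ) : walkCost S σ (SimpleGraph.Walk.nil : (nnGraph S).Walk x x) = 0 := rfl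

/-- Cost of a walk starting with the bond `⟨x, y⟩`. [cite: Balaban1984PropagatorsII, (2.46) p.231] -/
@[simp] theorem walkCost_cons {x y z : Fin d → ℤ} (h : (nnGraph S).Adj x y) (p : (nnGraph S).Walk y z) :
    walkCost S σ (SimpleGraph.Walk.cons h p) = min (σ x) (σ y) + walkCost S σ p := rfl

/-- Cost is additive under concatenation of walks. [cite: Balaban1984PropagatorsII, (2.46) p.231] -/
theorem walkCost_append {x y z : Fin d → ℤ} (p : (nnGraph S).Walk x y) (q : (nnGraph S).Walk y z) :
    walkCost S σ (p.append q) = walkCost S σ p + walkCost S σ q := by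
  induction p with
  | nil => simp
  | cons h p ih => rw [SimpleGraph.Walk.cons_append, walkCost_cons, walkCost_cons, ih, add_assoc]

variable {σ}

/-- Costs are non-negative when the scale is. [cite: Balaban1984PropagatorsII, (2.46) p.231] -/
theorem walkCost_nonneg (hσ : ∀ x, 0 ≤ σ x) {x z : Fin d → ℤ} (p : (nnGraph S).Walk x z) : 0 ≤ walkCost S σ p := by
  induction p with
  | nil => simp
  | cons h p ih => rw [walkCost_cons]; exact add_nonneg (le_min (hσ _) (hσ _)) ih

/-- The scaled distance is non-negative. [cite: Balaban1984PropagatorsII, (2.46) p.231] -/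
theorem lsDist_nonneg (hσ : ∀ x, 0 ≤ σ x) (x z : Fin d → ℤ) : 0 ≤ lsDist S σ x z := by
  unfold lsDist
  rcases isEmpty_or_nonempty ((nnGraph S).Walk x z) with h | h
  · rw [Real.iInf_of_isEmpty]
  · exact le_ciInf fun p => walkCost_nonneg S hσ p

/-- `d_σ(x, x) = 0`. [cite: Balaban1984PropagatorsII, (2.46) p.231] -/
theorem lsDist_self (hσ : ∀ x, 0 ≤ σ x) (x : Fin d → ℤ) : lsDist S σ x x = 0 := by
  refine le_antisymm ?_ (lsDist_nonneg S hσ x x)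
  unfold lsDist
  exact (ciInf_le ⟨0, fun r ⟨p, hp⟩ => hp ▸ walkCost_nonneg S hσ p⟩ SimpleGraph.Walk.nil).trans (le_of_eq (walkCost_nil S σ x))

/-! ## §3 The bond step: the distance from a fixed site is bond-Lipschitz with constant `min(σ(x), σ(z))` -/

/-- **BOND STEP**: for a bond `⟨x, z⟩` of `S`, `d_σ(w, z) ≤ d_σ(w, x) + min(σ(x), σ(z))` (extend every walk to `x` by the bond).
[cite: Balaban1984PropagatorsII, (2.46) p.231] -/
theorem lsDist_le_lsDist_add (hσ : ∀ x, 0 ≤ σ x) (w : Fin d → ℤ) {x z : Fin d → ℤ} (h : (nnGraph S).Adj x z) :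
    lsDist S σ w z ≤ lsDist S σ w x + min (σ x) (σ z) := by
  unfold lsDist
  rcases isEmpty_or_nonempty ((nnGraph S).Walk w x) with hE | hN
  · -- no walk to `x` ⇒ no walk to `z` either
    have hE' : IsEmpty ((nnGraph S).Walk w z) := by
      exact ⟨fun q => hE.false (q.append (SimpleGraph.Walk.cons h.symm SimpleGraph.Walk.nil))⟩
    rw [Real.iInf_of_isEmpty, Real.iInf_of_isEmpty, zero_add]
    exact le_min (hσ x) (hσ z)
  · have hbdd : BddBelow (Set.range fun q : (nnGraph S).Walk w z => walkCost S σ q) :=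
      ⟨0, fun r ⟨q, hq⟩ => hq ▸ walkCost_nonneg S hσ q⟩
    have hstep : ∀ p : (nnGraph S).Walk w x, (⨅ q : (nnGraph S).Walk w z, walkCost S σ q) ≤ walkCost S σ p + min (σ x) (σ z) := by
      intro p
      have hq := ciInf_le hbdd (p.append (SimpleGraph.Walk.cons h SimpleGraph.Walk.nil))
      rw [walkCost_append, walkCost_cons, walkCost_nil, add_zero] at hq
      exact hq
    have : (⨅ q : (nnGraph S).Walk w z, walkCost S σ q) - min (σ x) (σ z) ≤ ⨅ p : (nnGraph S).Walk w x, walkCost S σ p :=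
      le_ciInf fun p => by linarith [hstep p]
    linarith

/-- **BOND-LIPSCHITZ**: `|d_σ(w, x) − d_σ(w, z)| ≤ min(σ(x), σ(z))` across every bond of `S`. [cite: Balaban1984PropagatorsII, (2.46) p.231] -/
theorem abs_lsDist_sub_lsDist_le (hσ : ∀ x, 0 ≤ σ x) (w : Fin d → ℤ) {x z : Fin d → ℤ} (h : (nnGraph S).Adj x z) :
    |lsDist S σ w x - lsDist S σ w z| ≤ min (σ x) (σ z) := by
  have h1 := lsDist_le_lsDist_add S hσ w h
  have h2 := lsDist_le_lsDist_add S hσ w h.symm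
  rw [min_comm] at h2
  exact abs_sub_le_iff.mpr ⟨by linarith, by linarith⟩

/-! ## §4 The exponent `ρ = c·d_σ(x₀, ·)` is bond-Lipschitz at the tower scale -/

/-- The lattice neighbours `x`, `x ± e_μ` of `S` are adjacent in the region graph. [cite: Balaban1985RegularSpaces, p.77] -/
theorem adj_add_e {x : Fin d → ℤ} (hx : x ∈ S) (μ : Fin d) (h : x + e μ ∈ S) : (nnGraph S).Adj x (x + e μ) := by
  refine ⟨hx, h, ?_, μ, Or.inl rfl⟩
  intro heq
  have h1 := congrFun heq μ
  simp only [Pi.add_apply, e, Pi.single_eq_same] at h1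
  omega

/-- The lattice neighbours `x`, `x − e_μ` of `S` are adjacent in the region graph. [cite: Balaban1985RegularSpaces, p.77] -/
theorem adj_sub_e {x : Fin d → ℤ} (hx : x ∈ S) (μ : Fin d) (h : x - e μ ∈ S) : (nnGraph S).Adj x (x - e μ) := by
  refine ⟨hx, h, ?_, μ, Or.inr (by rw [sub_add_cancel])⟩
  intro heq
  have h1 := congrFun heq μ
  simp only [Pi.sub_apply, e, Pi.single_eq_same] at h1
  omega

/-- **THE SCALED DISTANCE GIVES ADMISSIBLE EXPONENTS** (the hypothesis `hlip` of `B8Eq191FlatDirichletLipschitzExponent`): if the scale satisfies `σ(x) ≤ L⁻ʲ` at every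
level-`j` tower site `x ∈ S`, then for every base point `x₀` and every `|c| ≤ δ′` the exponent `ρ = c·d_σ(x₀, ·)` obeys `|ρ(x) − ρ(x ± e_μ)| ≤ δ′·L⁻ʲ` across the bonds of `S`
at level-`j` tower sites. [cite: Balaban1984PropagatorsII, (2.46) p.231; Balaban1984PropagatorsI, p.36; Balaban1985RegularSpaces, (1.101) p.93] -/
theorem lipschitz_of_lsDist (hσ : ∀ x, 0 ≤ σ x) (L m : ℕ) (Λs : ℕ → Set (Fin d → ℤ))
    (hσL : ∀ x ∈ S, ∀ j, j ≤ m → blockMap (L ^ j) x ∈ Λs j → σ x ≤ (((L : ℝ) ^ j))⁻¹)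
    (x₀ : Fin d → ℤ) {c δ' : ℝ} (hc : |c| ≤ δ') :
    ∀ x ∈ S, ∀ j, j ≤ m → blockMap (L ^ j) x ∈ Λs j → ∀ μ : Fin d,
      (x + e μ ∈ S → |c * lsDist S σ x₀ x - c * lsDist S σ x₀ (x + e μ)| ≤ δ' * (((L : ℝ) ^ j))⁻¹) ∧
      (x - e μ ∈ S → |c * lsDist S σ x₀ x - c * lsDist S σ x₀ (x - e μ)| ≤ δ' * (((L : ℝ) ^ j))⁻¹) := by
  intro x hx j hj hxj μ
  have key : ∀ z, (nnGraph S).Adj x z → |c * lsDist S σ x₀ x - c * lsDist S σ x₀ z| ≤ δ' * (((L : ℝ) ^ j))⁻¹ := by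
    intro z hz
    rw [← mul_sub, abs_mul]
    have h1 := abs_lsDist_sub_lsDist_le S hσ x₀ hz
    have h2 : min (σ x) (σ z) ≤ (((L : ℝ) ^ j))⁻¹ := (min_le_left _ _).trans (hσL x hx j hj hxj)
    exact mul_le_mul hc (h1.trans h2) (abs_nonneg _) ((abs_nonneg c).trans hc)
  exact ⟨fun h => key _ (adj_add_e S hx μ h), fun h => key _ (adj_sub_e S hx μ h)⟩

/-! ## §5 The tower scale `σ(x) = L^{−j(x)}` -/

open Classical in
/-- **THE TOWER SCALE**: `σ(x) = Σ_{j ≤ m} [Bʲ(x) ∈ Λ_j]·L⁻ʲ` equals `L⁻ʲ` at a level-`j` tower site when a site lies in at most one tower block (`hdisj`), hence satisfies the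
hypothesis `hσL` of `lipschitz_of_lsDist` (with equality). [cite: Balaban1984PropagatorsII, (2.46) p.231; Balaban1985RegularSpaces, (1.5)–(1.6) p.77] -/
theorem towerScale_eq (L m : ℕ) (Λs : ℕ → Set (Fin d → ℤ))
    (hdisj : ∀ x ∈ S, ∀ j, j ≤ m → ∀ j', j' ≤ m → blockMap (L ^ j) x ∈ Λs j → blockMap (L ^ j') x ∈ Λs j' → j = j')
    {x : Fin d → ℤ} (hx : x ∈ S) {j : ℕ} (hj : j ≤ m) (hxj : blockMap (L ^ j) x ∈ Λs j) :
    (∑ j' ∈ Finset.range (m + 1), (if blockMap (L ^ j') x ∈ Λs j' then (((L : ℝ) ^ j'))⁻¹ else 0)) = (((L : ℝ) ^ j))⁻¹ := by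
  rw [Finset.sum_eq_single j]
  · rw [if_pos hxj]
  · intro j' hj' hne
    rw [if_neg]
    intro h'
    exact hne (hdisj x hx j' (Nat.lt_succ_iff.mp (Finset.mem_range.mp hj')) j hj h' hxj)
  · intro h
    exact absurd (Finset.mem_range.mpr (Nat.lt_succ_of_le hj)) h

open Classical in
/-- The tower scale is non-negative. [cite: Balaban1984PropagatorsII, (2.46) p.231] -/
theorem towerScale_nonneg (L m : ℕ) (Λs : ℕ → Set (Fin d → ℤ)) (x : Fin d → ℤ) :
    0 ≤ ∑ j' ∈ Finset.range (m + 1), (if blockMap (L ^ j') x ∈ Λs j' then (((L : ℝ) ^ j'))⁻¹ else 0) :=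
  Finset.sum_nonneg fun j _ => by split_ifs <;> positivity

open Classical in
/-- **ADMISSIBLE EXPONENTS FROM THE TOWER-SCALED DISTANCE**: with `σ` the tower scale and `hdisj`, `ρ = c·d_σ(x₀, ·)` (`|c| ≤ δ′`) is bond-Lipschitz at the tower
scale — the hypothesis `hlip` of `B8Eq191FlatDirichletLipschitzExponent.agmon_solve_flatDirichlet_of_lipschitz`, for every base point `x₀`.
[cite: Balaban1984PropagatorsII, (2.46) p.231; Balaban1984PropagatorsI, p.36; Balaban1985RegularSpaces, (1.101) p.93] -/
theorem lipschitz_of_towerDist (L m : ℕ) (Λs : ℕ → Set (Fin d → ℤ))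
    (hdisj : ∀ x ∈ S, ∀ j, j ≤ m → ∀ j', j' ≤ m → blockMap (L ^ j) x ∈ Λs j → blockMap (L ^ j') x ∈ Λs j' → j = j')
    (x₀ : Fin d → ℤ) {c δ' : ℝ} (hc : |c| ≤ δ') :
    ∀ x ∈ S, ∀ j, j ≤ m → blockMap (L ^ j) x ∈ Λs j → ∀ μ : Fin d,
      (x + e μ ∈ S →
        |c * lsDist S (fun x => ∑ j' ∈ Finset.range (m + 1), (if blockMap (L ^ j') x ∈ Λs j' then (((L : ℝ) ^ j'))⁻¹ else 0)) x₀ x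
          - c * lsDist S (fun x => ∑ j' ∈ Finset.range (m + 1), (if blockMap (L ^ j') x ∈ Λs j' then (((L : ℝ) ^ j'))⁻¹ else 0)) x₀ (x + e μ)|
          ≤ δ' * (((L : ℝ) ^ j))⁻¹) ∧
      (x - e μ ∈ S →
        |c * lsDist S (fun x => ∑ j' ∈ Finset.range (m + 1), (if blockMap (L ^ j') x ∈ Λs j' then (((L : ℝ) ^ j'))⁻¹ else 0)) x₀ x
          - c * lsDist S (fun x => ∑ j' ∈ Finset.range (m + 1), (if blockMap (L ^ j') x ∈ Λs j' then (((L : ℝ) ^ j'))⁻¹ else 0)) x₀ (x - e μ)|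
          ≤ δ' * (((L : ℝ) ^ j))⁻¹) :=
  lipschitz_of_lsDist S (towerScale_nonneg L m Λs) L m Λs
    (fun _ hx _ hj hxj => le_of_eq (towerScale_eq S L m Λs hdisj hx hj hxj)) x₀ hc

/-! ## §6 The test-function principle: bond-Lipschitz functions are dominated by the scaled distance -/

/-- **TEST-FUNCTION PRINCIPLE (walk form)**: if `|F(u) − F(v)| ≤ min(σ u, σ v)` across every bond of `S`, then along every walk `|F(x) − F(z)| ≤ cost`.
[cite: Balaban1984PropagatorsII, (2.46) p.231, Lemma 2.1 (2.60) p.234] -/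
theorem abs_sub_le_walkCost (F : (Fin d → ℤ) → ℝ) (hF : ∀ u v, (nnGraph S).Adj u v → |F u - F v| ≤ min (σ u) (σ v))
    {x z : Fin d → ℤ} (p : (nnGraph S).Walk x z) : |F x - F z| ≤ walkCost S σ p := by
  induction p with
  | nil => simp
  | cons h p ih =>
    rw [walkCost_cons]
    calc |F _ - F _| = |(F _ - F _) + (F _ - F _)| := by ring_nf
      _ ≤ |F _ - F _| + |F _ - F _| := abs_add_le _ _
      _ ≤ min (σ _) (σ _) + walkCost S σ p := add_le_add (hF _ _ h) ih

/-- **TEST-FUNCTION PRINCIPLE**: a bond-Lipschitz test function `F` bounds the scaled distance from below, `|F(x) − F(z)| ≤ d_σ(x, z)`, whenever `z` is reachable from `x`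
in `S` (the way LOWER bounds of the [B6] (2.46) distance are proved: exhibit a potential). [cite: Balaban1984PropagatorsII, (2.46) p.231, Lemma 2.1 (2.60)–(2.61) p.234] -/
theorem abs_sub_le_lsDist (F : (Fin d → ℤ) → ℝ) (hF : ∀ u v, (nnGraph S).Adj u v → |F u - F v| ≤ min (σ u) (σ v))
    {x z : Fin d → ℤ} (hreach : (nnGraph S).Reachable x z) : |F x - F z| ≤ lsDist S σ x z := by
  haveI : Nonempty ((nnGraph S).Walk x z) := hreach
  exact le_ciInf fun p => abs_sub_le_walkCost S F hF p

/-! ## §7 Reachability along lattice segments of `S` -/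

/-- If the whole lattice segment between `x` and `x + n·e_μ` lies in `S`, its endpoints are reachable from each other in the region graph. [folklore]
[cite: Balaban1984PropagatorsII, (2.46) p.231] -/
theorem reachable_add_nsmul_e {x : Fin d → ℤ} (μ : Fin d) :
    ∀ n : ℕ, (∀ i : ℕ, i ≤ n → x + (i : ℤ) • e μ ∈ S) → (nnGraph S).Reachable x (x + (n : ℤ) • e μ) := by
  intro n
  induction n with
  | zero => intro _; simp
  | succ n ih =>
    intro hseg
    have h1 : (nnGraph S).Reachable x (x + (n : ℤ) • e μ) := ih fun i hi => hseg i (Nat.le_succ_of_le hi)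
    have hn : x + (n : ℤ) • e μ ∈ S := hseg n (Nat.le_succ n)
    have hn1 : x + (n : ℤ) • e μ + e μ ∈ S := by
      have := hseg (n + 1) le_rfl
      rwa [show x + ((n + 1 : ℕ) : ℤ) • e μ = x + (n : ℤ) • e μ + e μ by push_cast; rw [add_smul, one_smul, add_assoc]] at this
    have h2 : (nnGraph S).Adj (x + (n : ℤ) • e μ) (x + (n : ℤ) • e μ + e μ) := adj_add_e S hn μ hn1
    have h3 : x + ((n + 1 : ℕ) : ℤ) • e μ = x + (n : ℤ) • e μ + e μ := by push_cast; rw [add_smul, one_smul, add_assoc]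
    rw [h3]
    exact h1.trans h2.reachable


end Literature.MathematicalPhysics.QuantumFieldTheory.Balaban1983to89.B8Eq191FlatDirichletDistance

end
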